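import Summits.CriticalPhenomena.PercolationContinuityZ3.Theorems.PercNearOneGluingNoHeavyLowerTailKnQuestion8TstarXFrameless
import HarnessLib

/-!
# KN Question 8 at `|A| = 3`: the three-point covariance-ratio inequality (XK)

Support file (`--supports stmt-CriticalPhenomena-4575`, closed crux; independent mathematics on Kozma–Nitzan's Question 8 at
`|A| = 3`, arXiv:2401.12397 §5.5 p. 36), prover `prim-ineq-gen-7` (gen 15).  No definitions, no named facts, no sorries; standard axioms.
Memo `prim-ineq-gen-7/FINDING-XD-g15.md` §3(d), §8.

For one percolation `μ = prodBernoulli w`, three vertices `x, v, k` and `f = F(C x)` with `F` monotone and nonnegative on vertex sets: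
      **(XK)   `μ(x↮v) · Cov(f, 1{x↔k})  ≥  μ({v↔k} ∩ {x↮v}) · Cov(f, 1{x↔v})`,**
i.e. the covariance of an increasing function of `C_x` with reaching `k` is at least `μ(k ∈ C_v | x↮v)` times its covariance with
reaching `v` ("reaching `v` is worth at least the conditional chance that `v` leads on to `k`").  It is the first-order germ (observer `o`
attached to a single vertex `k` with a small weight) of the x-class atom (T*) of the KN-Q8@3 chain at `Y = ∅`, and of its census-clean
framed analogue (XK_Y) (memo §8), which is the open first rung there.
* `PocketCert.xk_negCorr` — `μ(x↮v)·∫_{{x↮v}∩{v↔k}} f ≤ μ({x↮v}∩{v↔k})·∫_{x↮v} f`: van den Berg–Häggström–Kahn Thm 1.4/2.1 with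
  `S = {x}`, `T = {v}` (`F(C x)` increasing in `C_S`, `1{v↔k}` increasing in `C_T`, negatively correlated given `S↮T`).
* `PocketCert.xk_threePoint` — (XK): `{x↔k} ⊔ ({v↔k}∩{x↮v}) = {x↔k} ∪ {v↔k}` is increasing, so Harris
  (`AGloc.setIntegral_clusterFun_ge`) bounds `∫_{x↔k} f + ∫_{{v↔k}∩{x↮v}} f` below by `(μ(x↔k)+μ({v↔k}∩{x↮v}))·∫ f`; with `xk_negCorr`,
  `μ(x↮v)`-times the Harris slack plus the negative-correlation slack is the claim.
[cite: VandenbergHaggstromKahn2005, Thm. 1.4 (p. 7), Thm. 2.1 (p. 9)] [cite: KozmaNitzan2024, Question 8 (§5.5 p. 36)]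
-/

namespace Summit.CriticalPhenomena.PercolationContinuityZ3.Theorems

open MeasureTheory Set Literature.Probability.LatticeModels Literature.Probability.Percolation
open scoped Classical
open KNPreFKG

noncomputable section

namespace PocketCert

variable {V : Type*} [Fintype V]

/-- **Negative correlation across `{x↮v}`.**  `μ(x↮v)·∫_{{x↮v}∩{v↔k}} F(C x) ≤ μ({x↮v}∩{v↔k})·∫_{x↮v} F(C x)` for `F` monotone:
vdBHK Thm 1.4/2.1 (`q = 1`) with `S = {x}`, `T = {v}` on `{S↮T} = {x↮v}`.
[cite: VandenbergHaggstromKahn2005, Thm. 1.4 (p. 7), Thm. 2.1 (p. 9)] -/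
theorem xk_negCorr (w : Sym2 V → unitInterval) (x v k : V) (F : Set V → ℝ)
    (hF : ∀ S T : Set V, S ⊆ T → F S ≤ F T) :
    (prodBernoulli w).real {ω : BondConfig V | ¬ (openGraph ω).Reachable x v} *
      ∫ ω in {ω : BondConfig V | ¬ (openGraph ω).Reachable x v} ∩ openConn v k, F (openCluster ω x) ∂(prodBernoulli w) ≤
    (prodBernoulli w).real ({ω : BondConfig V | ¬ (openGraph ω).Reachable x v} ∩ openConn v k) *
      ∫ ω in {ω : BondConfig V | ¬ (openGraph ω).Reachable x v}, F (openCluster ω x) ∂(prodBernoulli w) := by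
  classical
  set μ := prodBernoulli w with hμ
  set f : BondConfig V → ℝ := fun ω => F (openCluster ω x) with hf
  set D : Set (BondConfig V) := {ω : BondConfig V | ¬ (openGraph ω).Reachable x v} with hD
  -- vdBHK Thm 2.1, `S = {x}`, `T = {v}`
  set S : Set V := {x} with hS
  set T : Set V := {v} with hT
  set Fe : Set (Sym2 V) → ℝ := fun C => F (openCluster C x) with hFe
  set Ge : Set (Sym2 V) → ℝ := fun C => if (openGraph C).Reachable v k then 1 else 0 with hGe
  have hFe_mono : Monotone Fe := fun C C' hCC' => hF _ _ (openCluster_mono hCC' x)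
  have hGe_mono : Monotone Ge := by
    intro C C' hCC'
    simp only [hGe]
    by_cases h : (openGraph C).Reachable v k
    · rw [if_pos h, if_pos (h.mono (openGraph_mono hCC'))]
    · rw [if_neg h]; split_ifs <;> norm_num
  have hD_ST : {ω : BondConfig V | ∀ s ∈ S, ∀ t ∈ T, ¬ (openGraph ω).Reachable s t} = D := by
    ext ω
    simp only [hS, hT, hD, mem_setOf_eq, mem_singleton_iff, forall_eq]
  have hFe_eq : ∀ ω : BondConfig V, Fe (⋃ s ∈ S, openEdgeCluster ω s) = f ω := by
    intro ω
    simp only [hFe, hf]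
    congr 1
    ext a
    exact (KNSep.reachable_iff_cluster ω S (show x ∈ S by simp [hS]) a).symm
  have hGe_eq : ∀ ω : BondConfig V, Ge (⋃ t ∈ T, openEdgeCluster ω t) =
      (openConn v k : Set (BondConfig V)).indicator 1 ω := by
    intro ω
    simp only [hGe]
    rw [← KNSep.reachable_iff_cluster ω T (show v ∈ T by simp [hT]) k]
    by_cases h : (openGraph ω).Reachable v k
    · rw [if_pos h, indicator_of_mem (show ω ∈ openConn v k from h), Pi.one_apply]
    · rw [if_neg h, indicator_of_notMem (show ω ∉ openConn v k from h)]
  have hBHK := BHK2006_twoSetConditionalAssociation.negCorrelation w S T Fe Ge hFe_mono hGe_mono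
  rw [hD_ST] at hBHK
  simp_rw [hFe_eq, hGe_eq] at hBHK
  rw [setIntegral_mul_indicator_one μ D (openConn v k) f, setIntegral_indicator_one_eq μ D (openConn v k)] at hBHK
  -- hBHK : μ D * ∫_{D ∩ {v↔k}} f ≤ (∫_D f) * μ (D ∩ {v↔k})
  change μ.real D * ∫ ω in D ∩ openConn v k, f ω ∂μ ≤ μ.real (D ∩ openConn v k) * ∫ ω in D, f ω ∂μ
  linarith [hBHK, mul_comm (∫ ω in D, f ω ∂μ) (μ.real (D ∩ openConn v k))]

/-- **(XK), the three-point covariance-ratio inequality.**  For `F` monotone nonnegative on vertex sets and `f = F(C x)`: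
`μ({x↮v}∩{v↔k}) · ( ∫_{x↔v} f − μ(x↔v)·∫ f ) ≤ μ(x↮v) · ( ∫_{x↔k} f − μ(x↔k)·∫ f )`,
i.e. `Cov(f,1{x↔k}) ≥ μ(v↔k | x↮v)·Cov(f,1{x↔v})`.  Harris on `{x↔k} ∪ {v↔k}` plus `xk_negCorr`.
[cite: VandenbergHaggstromKahn2005, Thm. 1.4 (p. 7), Thm. 2.1 (p. 9)] [cite: KozmaNitzan2024, Question 8 (§5.5 p. 36)] -/
theorem xk_threePoint (w : Sym2 V → unitInterval) (x v k : V) (F : Set V → ℝ)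
    (hF : ∀ S T : Set V, S ⊆ T → F S ≤ F T) (hF0 : ∀ S, 0 ≤ F S) :
    (prodBernoulli w).real ({ω : BondConfig V | ¬ (openGraph ω).Reachable x v} ∩ openConn v k) *
        (∫ ω in openConn x v, F (openCluster ω x) ∂(prodBernoulli w) -
          (prodBernoulli w).real (openConn x v) * ∫ ω, F (openCluster ω x) ∂(prodBernoulli w)) ≤
    (prodBernoulli w).real {ω : BondConfig V | ¬ (openGraph ω).Reachable x v} *
        (∫ ω in openConn x k, F (openCluster ω x) ∂(prodBernoulli w) -
          (prodBernoulli w).real (openConn x k) * ∫ ω, F (openCluster ω x) ∂(prodBernoulli w)) := by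
  classical
  set μ := prodBernoulli w with hμ
  set f : BondConfig V → ℝ := fun ω => F (openCluster ω x) with hf
  have hmeas : ∀ S' : Set (BondConfig V), MeasurableSet S' := fun _ => MeasurableSet.of_discrete
  have hint : ∀ (g : BondConfig V → ℝ) (S' : Set (BondConfig V)), IntegrableOn g S' μ :=
    fun g S' => (Integrable.of_finite).integrableOn
  have hn := fun (S' : Set (BondConfig V)) => (measureReal_nonneg : 0 ≤ μ.real S')
  have hfi := fun (S' : Set (BondConfig V)) =>
    (setIntegral_nonneg (hmeas S') fun ω _ => hF0 (openCluster ω x) : 0 ≤ ∫ ω in S', f ω ∂μ)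
  -- the cells
  set D : Set (BondConfig V) := {ω : BondConfig V | ¬ (openGraph ω).Reachable x v} with hD
  set Vx : Set (BondConfig V) := openConn x v with hVx
  set J : Set (BondConfig V) := openConn x k with hJ
  set Et : Set (BondConfig V) := {ω : BondConfig V | ¬ (openGraph ω).Reachable x v} ∩ openConn v k with hEt
  set U2 : Set (BondConfig V) := openConn x k ∪ openConn v k with hU2
  -- set algebra: `U2 = J ⊔ Et`, `univ = Vx ⊔ D`
  have hU2eq : U2 = J ∪ Et := by
    ext ω
    simp only [hU2, hJ, hEt, mem_union, mem_inter_iff, mem_setOf_eq, openConn]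
    constructor
    · rintro (hxk | hvk)
      · exact Or.inl hxk
      · by_cases hxk : (openGraph ω).Reachable x k
        · exact Or.inl hxk
        · exact Or.inr ⟨fun hxv => hxk (hxv.trans hvk), hvk⟩
    · rintro (hxk | ⟨-, hvk⟩)
      · exact Or.inl hxk
      · exact Or.inr hvk
  have hdJE : Disjoint J Et := by
    rw [Set.disjoint_left]
    rintro ω hxk ⟨hxv, hvk⟩
    exact hxv (hxk.trans hvk.symm)
  have hUniv : (univ : Set (BondConfig V)) = Vx ∪ D := by
    ext ω
    simp only [hVx, hD, mem_univ, mem_union, mem_setOf_eq, openConn, true_iff]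
    exact em _
  have hdVD : Disjoint Vx D := by
    rw [Set.disjoint_left]
    rintro ω hxv hnxv
    exact hnxv hxv
  have eU2 : μ.real U2 = μ.real J + μ.real Et := by rw [hU2eq, measureReal_union hdJE (hmeas _)]
  have iU2 : ∫ ω in U2, f ω ∂μ = ∫ ω in J, f ω ∂μ + ∫ ω in Et, f ω ∂μ := by
    rw [hU2eq, setIntegral_union hdJE (hmeas _) (hint _ _) (hint _ _)]
  have eTot : μ.real Vx + μ.real D = 1 := by
    rw [← measureReal_union hdVD (hmeas _), ← hUniv, probReal_univ]
  have iTot : ∫ ω, f ω ∂μ = ∫ ω in Vx, f ω ∂μ + ∫ ω in D, f ω ∂μ := by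
    rw [← setIntegral_univ, hUniv, setIntegral_union hdVD (hmeas _) (hint _ _) (hint _ _)]
  -- (1) Harris on the increasing event `U2 = {x↔k} ∪ {v↔k}`
  have hHarris : μ.real U2 * ∫ ω, f ω ∂μ ≤ ∫ ω in U2, f ω ∂μ :=
    AGloc.setIntegral_clusterFun_ge w x F hF hF0 U2 ((isUpperSet_openConn x k).union (isUpperSet_openConn v k))
  -- (2) negative correlation across `{x↮v}`
  have hNC := xk_negCorr w x v k F hF
  change μ.real D * ∫ ω in Et, f ω ∂μ ≤ μ.real Et * ∫ ω in D, f ω ∂μ at hNC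
  -- (3) assemble:  μ(D)·[I_J + I_Et − (μJ+μEt)·I] + [μEt·I_D − μD·I_Et] = the claim
  rw [eU2, iU2] at hHarris
  have h1 : 0 ≤ (∫ ω in J, f ω ∂μ + ∫ ω in Et, f ω ∂μ) - (μ.real J + μ.real Et) * ∫ ω, f ω ∂μ := by
    linarith [hHarris]
  have h2 : 0 ≤ μ.real Et * ∫ ω in D, f ω ∂μ - μ.real D * ∫ ω in Et, f ω ∂μ := by linarith [hNC]
  have h3 := mul_nonneg (hn D) h1
  have hVxe : μ.real Vx = 1 - μ.real D := by linarith [eTot]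
  change μ.real Et * (∫ ω in Vx, f ω ∂μ - μ.real Vx * ∫ ω, f ω ∂μ) ≤
    μ.real D * (∫ ω in J, f ω ∂μ - μ.real J * ∫ ω, f ω ∂μ)
  rw [iTot, hVxe]
  rw [iTot] at h3
  nlinarith [h3, h2, hn D, hn Et, hn J, hfi J, hfi Et, hfi D, hfi Vx]

end PocketCert

end

end Summit.CriticalPhenomena.PercolationContinuityZ3.Theorems
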